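import Summits.QuantumAdvantage.QuantumAdvantage.Theorems.SparsityDialMP2

/-!
# SparsityDial — part MP3 of 10 of the «MovingPointers» package (decomp-qadv lens 2, g18): §T6 twin S-form below piece S; §M1 m-phase occupation profile and stretch selection

Imports its predecessor `SparsityDialMP2` (linear chain MP1 → … → MP10); the package overview is the module docstring of `SparsityDialMP1`.
No `sorry`; standard axioms; no instances / notation.
-/

set_option linter.unusedVariables false
set_option linter.dupNamespace false

noncomputable section
open scoped Classical

namespace Summit.QuantumAdvantage.QuantumAdvantage.Theorems.SparsityDial

open Finset
open Literature.Computability.QuantumComplexity Literature.Computability.QuantumComplexity.RingHLF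
open Literature.Computability.MetaComplexity Literature.Computability.MetaComplexity.Smolensky
open Summit.QuantumAdvantage.AdviceFreeQNC0
open Summit.QuantumAdvantage.QuantumAdvantage.Theorems.HolonomyDial (gCond)
open Summit.QuantumAdvantage.QuantumAdvantage.Theorems.LocusDial
open Summit.QuantumAdvantage.QuantumAdvantage.Theorems.AnchorDial (dev outB win_iff card_odd_ge)
open Summit.QuantumAdvantage.QuantumAdvantage.Theorems.HolonomyDial (card_odd_le)
open Summit.QuantumAdvantage.QuantumAdvantage.Theorems.StabilizerDial (eventually_polylog StabFew stabFew_of_fewLocus)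

/-! ## §T6  The S-restricted form: LITERALLY a sub-case of piece S (by name, against the landed `Theorems.SparsityDialA`) -/

section SRung
variable {N t : ℕ}

/-- a twin-pointer strategy is few-locus at `(2, 0)` EVERYWHERE (its deviation set has two points). -/
theorem fewLocus_two_of_dev_pair (M : Fin t → Fin N → ZMod 3) (π₁ π₂ : (Fin t → ZMod 3) → Fin N)
    (P : Fin N → CubeFn (ZMod 3) N) (hdev : ∀ x, OddZeros x → dev P x = {π₁ (linHash M x), π₂ (linHash M x)}) :
    FewLocus 2 0 P := by
  have hcov : ∀ x : Fin N → Bool, OddZeros x → Coverable 2 0 (dev P x) := by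
    intro x hx
    rw [hdev x hx]
    refine ⟨fun i => if i.val = 0 then (π₁ (linHash M x)).val else (π₂ (linHash M x)).val, ?_⟩
    intro j hj
    rw [mem_insert, mem_singleton] at hj
    rcases hj with rfl | rfl
    · exact ⟨⟨0, by omega⟩, by simp⟩
    · exact ⟨⟨1, by omega⟩, by simp⟩
  have hempty : (univ.filter fun x : Fin N → Bool => OddZeros x ∧ ¬ Coverable 2 0 (dev P x)) = ∅ :=
    filter_eq_empty_iff.mpr fun x _ h => h.2 (hcov x h.1)
  show Nat.log 2 N * _ ≤ _
  rw [hempty, card_empty, mul_zero]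
  exact Nat.zero_le _

/-- **`TwinAffinePointerLossS3`** — the twin-pointer family RESTRICTED to piece S's hypotheses (low degree, no cheap
one-point normal form): literally a sub-case of `SparseGenericLoss3` (`twinS_of_sparse`) AND proved outright
(`twinAffinePointerLossS3`). -/
def TwinAffinePointerLossS3 : Prop := ∃ C : ℕ, ∀ c : ℕ, ∃ n₀ : ℕ, ∀ n ≥ n₀, ∀ t ≤ (Nat.log 2 n) ^ c,
  ∀ (M : Fin t → Fin n → ZMod 3) (π₁ π₂ : (Fin t → ZMod 3) → Fin n),
    (∀ v, n / 4 ≤ (π₁ v).val ∧ (π₁ v).val + n / 4 ≤ (π₂ v).val) →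
    ∀ P : Fin n → CubeFn (ZMod 3) n, (∀ i, P i ∈ lowDeg (ZMod 3) n ((Nat.log 2 n) ^ c)) →
      ¬ StabFew 1 0 (c + 1) P →
      (∀ x, OddZeros x → dev P x = {π₁ (linHash M x), π₂ (linHash M x)}) →
      ((univ.filter fun x : Fin n → Bool => OddZeros x ∧ Rel x (fun i => decide (P i x = 1))).card : ℝ) ≤
        (1 - 1 / (n : ℝ) ^ C) * (2 : ℝ) ^ (n - 1)

/-- BY NAME: piece S (the landed `Theorems.SparsityDial.SparseGenericLoss3`, verbatim the node's S) implies the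
S-restricted twin-pointer statement (sparsity scale `a = 1`: two points are `≤ log₂ n` points for `n ≥ 4`). -/
theorem twinS_of_sparse (hS : SparseGenericLoss3) : TwinAffinePointerLossS3 := by
  obtain ⟨C, hC⟩ := hS 1
  refine ⟨C, fun c => ?_⟩
  obtain ⟨n₀, hn₀⟩ := hC c
  refine ⟨max n₀ 4, fun n hn t ht M π₁ π₂ hsep P hdeg hnot hdev => ?_⟩
  have hn4 : 4 ≤ n := le_trans (le_max_right _ _) hn
  have hlog : 2 ≤ (Nat.log 2 n) ^ 1 := by
    rw [pow_one]
    exact Nat.le_log_of_pow_le (by norm_num) (by omega)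
  exact hn₀ n (le_trans (le_max_left _ _) hn) P hdeg
    (stabFew_mono_mr hlog (by norm_num) (le_refl 0) (stabFew_of_fewLocus (c + 1) (fewLocus_two_of_dev_pair M π₁ π₂ P hdev)))
    hnot

/-- the unrestricted theorem implies the restricted statement (drop two hypotheses). -/
theorem twinS_of_twin (h : TwinAffinePointerLoss3) : TwinAffinePointerLossS3 := by
  obtain ⟨C, hC⟩ := h
  refine ⟨C, fun c => ?_⟩
  obtain ⟨n₀, hn₀⟩ := hC c
  exact ⟨n₀, fun n hn t ht M π₁ π₂ hsep P _ _ hdev => hn₀ n hn t ht M π₁ π₂ hsep P hdev⟩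

/-- **S's first MOVING-POINTER rung, PROVED.** -/
theorem twinAffinePointerLossS3 : TwinAffinePointerLossS3 := twinS_of_twin twinAffinePointerLoss3

end SRung

/-- info: 'Summit.QuantumAdvantage.QuantumAdvantage.Theorems.SparsityDial.twinAffinePointerLossS3' depends on axioms: [propext,
 Classical.choice,
 Quot.sound] -/
#guard_msgs in #print axioms twinAffinePointerLossS3
/-- info: 'Summit.QuantumAdvantage.QuantumAdvantage.Theorems.SparsityDial.twinS_of_sparse' depends on axioms: [propext,
 Classical.choice,
 Quot.sound] -/
#guard_msgs in #print axioms twinS_of_sparse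

/-! ## §M1  m kernel phases: occupation profile, stretch selection, character-sum bound -/

section MultiPhase
variable {N : ℕ}

/-- occupation phases of `Σ_l α_l·(W_{k_l} + W)`. -/
def occM (N : ℕ) {m : ℕ} (α : Fin m → ZMod 3) (k : Fin m → ℕ) : ℕ → ZMod 3 :=
  fun i => ∑ l : Fin m, α l * ((if i < k l then 1 else 0) + (if i < N - 1 then 1 else 0))

/-- SparsityDial «MovingPointers» helper `phaseK_appM` (decomp-qadv lens-2 g18 land package; see the module docstring). -/
theorem phaseK_appM (μ' : Fin N → ZMod 3) {m : ℕ} (α : Fin m → ZMod 3) (k : Fin m → ℕ) (x : Fin N → Bool) :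
    phaseK (μA μ') (occM N α k) N x =
      (∑ i : Fin N, μ' i * (if x i then 1 else 0)) +
        ∑ l : Fin m, α l * (((Wk x (k l) : ℕ) : ZMod 3) + ((Wk x (N - 1) : ℕ) : ZMod 3)) := by
  have hR : (∑ l : Fin m, α l * (((Wk x (k l) : ℕ) : ZMod 3) + ((Wk x (N - 1) : ℕ) : ZMod 3))) =
      ∑ i : Fin N, ∑ l : Fin m, α l * ((if (i.val < k l ∧ uCoord x i = true) then (1 : ZMod 3) else 0) +
        (if (i.val < N - 1 ∧ uCoord x i = true) then (1 : ZMod 3) else 0)) := by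
    rw [sum_comm]
    apply sum_congr rfl
    intro l _
    rw [Wk_cast x (k l), Wk_cast x (N - 1), ← sum_add_distrib, mul_sum]
  rw [hR, ← sum_add_distrib]
  unfold phaseK
  apply sum_congr rfl
  intro i _
  rw [if_pos i.isLt]
  have hμ : μA μ' i.val = μ' i := by
    unfold μA; rw [dif_pos i.isLt]
  rw [hμ]
  unfold occM
  by_cases hu : uCoord x i = true
  · simp only [hu, and_true, if_true, mul_one]
  · simp [hu]

/-- **stretch selection**: for `α ≠ 0` and sorted pointers with gaps `≥ 2j` (first pointer `≥ 2j`), the occupation profile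
`occM` is non-zero on some window of `2j` consecutive steps: the prefix if `Σ α ≠ 0`, else the stretch just before the LAST
index carrying a non-zero `α`. -/
theorem occM_stretch {m : ℕ} (α : Fin m → ZMod 3) (hα : α ≠ 0) (k : Fin m → ℕ) (j : ℕ)
    (h2j : ∀ l, 2 * j ≤ k l) (hmono : ∀ l l' : Fin m, l ≤ l' → k l ≤ k l')
    (hgap : ∀ l l' : Fin m, l.val + 1 = l'.val → k l + 2 * j ≤ k l') (hkN : ∀ l, k l + 1 ≤ N) :
    ∃ m₀ : ℕ, m₀ + 2 * j ≤ N ∧ ∀ i, m₀ ≤ i → i + 2 ≤ m₀ + 2 * j → occM N α k i ≠ 0 := by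
  set S := (univ : Finset (Fin m)).filter (fun l => α l ≠ 0) with hS
  have hSne : S.Nonempty := by
    by_contra h
    rw [not_nonempty_iff_eq_empty] at h
    apply hα
    funext l
    by_contra hl
    have hmem : l ∈ S := by rw [hS, mem_filter]; exact ⟨mem_univ _, hl⟩
    rw [h] at hmem
    simp at hmem
  obtain ⟨l0, hl0⟩ := id hSne
  set ls := S.max' hSne with hls
  have hls_ne : α ls ≠ 0 := by
    have h : ls ∈ S := S.max'_mem hSne
    rw [hS, mem_filter] at h
    exact h.2
  have hbeyond : ∀ l : Fin m, ls < l → α l = 0 := by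
    intro l hl
    by_contra h
    have hmem : l ∈ S := by rw [hS, mem_filter]; exact ⟨mem_univ _, h⟩
    exact absurd (S.le_max' l hmem) (not_le.mpr hl)
  by_cases hT : (∑ l : Fin m, α l) = 0
  · -- the stretch before the last non-zero index
    have hls0 : ls.val ≠ 0 := by
      intro h0
      apply hls_ne
      have hsum : (∑ l : Fin m, α l) = α ls := by
        rw [Finset.sum_eq_single ls]
        · intro l _ hne
          apply hbeyond l
          rw [Fin.lt_def]
          have : l.val ≠ ls.val := fun h => hne (Fin.ext h)
          omega
        · intro h; exact absurd (mem_univ _) h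
      rw [← hsum]; exact hT
    have hlsm : ls.val < m := ls.isLt
    set lp : Fin m := ⟨ls.val - 1, by omega⟩ with hlp
    have hgap' : k lp + 2 * j ≤ k ls := hgap lp ls (by simp only [hlp]; omega)
    refine ⟨k lp, ?_, ?_⟩
    · have := hkN ls; omega
    · intro i hi1 hi2
      have hi_ls : i < k ls := by omega
      have hiN : i < N - 1 := by have := hkN ls; omega
      have hsplit : occM N α k i = (∑ l : Fin m, α l * (if i < k l then 1 else 0)) + ∑ l : Fin m, α l := by
        unfold occM
        rw [← sum_add_distrib]
        apply sum_congr rfl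
        intro l _
        rw [if_pos hiN]; ring
      have hfirst : (∑ l : Fin m, α l * (if i < k l then (1 : ZMod 3) else 0)) = α ls := by
        rw [Finset.sum_eq_single ls]
        · rw [if_pos hi_ls, mul_one]
        · intro l _ hne
          rcases lt_or_gt_of_ne hne with h | h
          · have hle : l ≤ lp := by
              rw [Fin.le_def]
              rw [Fin.lt_def] at h
              simp only [hlp]
              omega
            have := hmono l lp hle
            rw [if_neg (by omega), mul_zero]
          · rw [hbeyond l h, zero_mul]
        · intro h; exact absurd (mem_univ _) h
      rw [hsplit, hfirst, hT, add_zero]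
      exact hls_ne
  · -- the prefix
    refine ⟨0, ?_, ?_⟩
    · have := h2j l0; have := hkN l0; omega
    · intro i _ hi2
      have hocc : occM N α k i = 2 * ∑ l : Fin m, α l := by
        unfold occM
        rw [mul_sum]
        apply sum_congr rfl
        intro l _
        have h1 : i < k l := by have := h2j l; omega
        have h2 : i < N - 1 := by have := h2j l0; have := hkN l0; omega
        rw [if_pos h1, if_pos h2]; ring
      rw [hocc]
      intro h
      apply hT
      have key : ∀ a : ZMod 3, 2 * a = 0 → a = 0 := by decide
      exact key _ h

/-- **m-phase odd-class character sum bound** (stretch form). -/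
theorem normSq_appSumM_le (μ' : Fin N → ZMod 3) {m : ℕ} (α : Fin m → ZMod 3) (hα : α ≠ 0) (k : Fin m → ℕ)
    (j : ℕ) (h2j : ∀ l, 2 * j ≤ k l) (hmono : ∀ l l' : Fin m, l ≤ l' → k l ≤ k l')
    (hgap : ∀ l l' : Fin m, l.val + 1 = l'.val → k l + 2 * j ≤ k l') (hkN : ∀ l, k l + 1 ≤ N) :
    Complex.normSq (∑ x ∈ (univ : Finset (Fin N → Bool)).filter (fun x => OddZeros x),
      χ ((∑ i : Fin N, μ' i * (if x i then 1 else 0)) +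
        ∑ l : Fin m, α l * (((Wk x (k l) : ℕ) : ZMod 3) + ((Wk x (N - 1) : ℕ) : ZMod 3)))) ≤
      4 ^ (N - 2 * j) * 12 ^ j := by
  obtain ⟨m₀, hm₀, hc⟩ := occM_stretch (N := N) α hα k j h2j hmono hgap hkN
  have h := normSq_oddSum_le_stretch (N := N) (μA μ') (occM N α k) m₀ j hm₀ hc
  simp_rw [phaseK_appM] at h
  exact h

/-- from a stretch `normSq` bound to the usable norm form `16·3^t·‖Z‖ ≤ 2^N` (`8t + 20 ≤ j ≤ N/2`). -/
theorem norm_of_normSq_budget (Z : ℂ) (t N j : ℕ) (h2j : 2 * j ≤ N) (hjt : 8 * t + 20 ≤ j)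
    (hn1 : Complex.normSq Z ≤ 4 ^ (N - 2 * j) * 12 ^ j) : (16 : ℝ) * 3 ^ t * ‖Z‖ ≤ 2 ^ N := by
  have hn2 := pow_budget2 t N j h2j hjt
  rw [Complex.normSq_eq_norm_sq] at hn1
  have hsq : ((16 : ℝ) * 3 ^ t * ‖Z‖) ^ 2 ≤ ((2 : ℝ) ^ N) ^ 2 := by
    have e : ((2 : ℝ) ^ N) ^ 2 = 4 ^ N := by rw [← pow_mul, mul_comm, pow_mul]; norm_num
    rw [e]
    have : (0 : ℝ) ≤ 256 * 9 ^ t := by positivity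
    calc ((16 : ℝ) * 3 ^ t * ‖Z‖) ^ 2 = 256 * 9 ^ t * ‖Z‖ ^ 2 := by
          rw [mul_pow, mul_pow, ← pow_mul, show (16 : ℝ) ^ 2 = 256 by norm_num]
          congr 2
          rw [mul_comm, pow_mul]; norm_num
      _ ≤ 256 * 9 ^ t * (4 ^ (N - 2 * j) * 12 ^ j) := mul_le_mul_of_nonneg_left hn1 this
      _ ≤ 4 ^ N := hn2
  have ha0 : (0 : ℝ) ≤ 16 * 3 ^ t * ‖Z‖ := by positivity
  have hb0 : (0 : ℝ) ≤ 2 ^ N := by positivity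
  calc (16 : ℝ) * 3 ^ t * ‖Z‖ = Real.sqrt (((16 : ℝ) * 3 ^ t * ‖Z‖) ^ 2) := (Real.sqrt_sq ha0).symm
    _ ≤ Real.sqrt (((2 : ℝ) ^ N) ^ 2) := Real.sqrt_le_sqrt hsq
    _ = 2 ^ N := Real.sqrt_sq hb0

end MultiPhase


end Summit.QuantumAdvantage.QuantumAdvantage.Theorems.SparsityDial
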